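import Literature.Geometry.Riemannian.HamiltonCurvatureODE
import Literature.Geometry.Riemannian.CurvatureDecompositionProofs
import Mathlib.Analysis.ODE.Gronwall
import Mathlib.Analysis.Calculus.Deriv.Prod
import HarnessLib

/-!
# The linear constraints of Hamilton's curvature ODE: `A, C` symmetric and `tr A = tr C`
(topic `Geometry/Riemannian`)

Support file of the decomposition of `Literature.Geometry.Riemannian.hamilton_chenZhu_pinching`
(`PinchingEstimates.lean`), over `HamiltonCurvatureODE.lean`. Hamilton's ODE `M' = M² + M^#`
(1986) lives on *symmetric* forms `M = (A B; ᵗB C)` on `Λ²` (so `A, C` are symmetric, `B`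
arbitrary) satisfying the first Bianchi identity, which in the block picture is `tr A = tr C`
(Hamilton 1997, p. 9: "the first Bianchi identity for `n = 4`"; Chen–Zhu 2006, p. 4:
"`tr A = tr C = ½R` by … the Bianchi identity"); "it is easy to see that the Bianchi identity is
preserved" (Hamilton 1986, p. 166). The block triples of `HamiltonODE.Blocks` carry neither
constraint, and Hamilton's pinching estimates are false for non-symmetric `A` (for
`A = ½m·1 + S`, `S` skew with a long axis `w`, one has `d/dt (e₀ᵀAe₀ + e₁ᵀAe₁) = 2(¾m² - |w|²) < 0`
at the boundary of `{a₁ + a₂ ≥ m}`), so both constraints have to be threaded through the chain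
of invariant sets; this file PROVES everything needed for that:

* ODE side — `HamiltonODE.isInvariant_trace_eq` (`{tr A = tr C}` is forward invariant: along a
  solution `y = tr A - tr C` satisfies `y' = y (tr A + tr C)`, Grönwall), and
  `HamiltonODE.isInvariant_isSymm` (`{A, C symmetric}` is forward invariant: by the
  Cayley–Hamilton form of the adjugate, `D = A - ᵗA` satisfies the *linear* equation
  `D' = 2 (tr A) D - (A D + D ᵗA)`, Grönwall again);
* manifold side — for the blocks of any Levi-Civita connection (O'Neill 1983, Prop. 3.36:
  pair symmetry, skew-adjointness, first Bianchi identity): `blockA_isSymm`, `blockC_isSymm` and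
  `trace_blockA_eq_trace_blockC`.

## References

* R. S. Hamilton, J. Differential Geom. 24 (1986), §2 (p. 157, `M^#`), §6 (p. 166: `tr A = tr C`
  is preserved; `tr A² + 2 tr A^# = (tr A)²`). [Hamilton1986]
* R. S. Hamilton, Comm. Anal. Geom. 5 (1997), §1.2 (p. 5, the blocks), §2.1 (p. 9, Bianchi). [Hamilton1997]
* B.-L. Chen, X.-P. Zhu, J. Differential Geom. 74 (2006), §2, p. 4. [ChenZhu2006]
* B. O'Neill, *Semi-Riemannian geometry*, Academic Press 1983, Ch. 3, Prop. 3.36. [ONeill1983]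
-/

noncomputable section

open Set Bundle
open scoped Manifold ContDiff Topology Matrix BigOperators

namespace Literature.Geometry.Riemannian

open Lorentzian Lorentzian.PseudoRiemannianMetric

/-! ### Manifold side: the blocks of a Levi-Civita connection -/

section LeviCivita

variable {E : Type*} [NormedAddCommGroup E] [NormedSpace ℝ E] {H : Type*} [TopologicalSpace H]
  {I : ModelWithCorners ℝ E H} {M : Type*} [TopologicalSpace M] [ChartedSpace H M]
  [IsManifold I ∞ M] {n : ℕ∞ω} [FiniteDimensional ℝ E] [CompleteSpace E]
  {g : PseudoRiemannianMetric I n E (TangentSpace I : M → Type _)}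
  {cov : CovariantDerivative I E (TangentSpace I : M → Type _)}

/-- **Hamilton's pairing is symmetric**: `R(X∧Y, Z∧W) = R(Z∧W, X∧Y)` for the curvature of a
Levi-Civita connection of a `C^n` metric, `n ≥ 2` (pair symmetry with antisymmetry and
skew-adjointness, O'Neill 1983, Prop. 3.36). [cite: ONeill1983, Ch. 3, Prop. 3.36 (4), pp. 75–76] -/
theorem bivectorCurvature_symm (h : g.IsLeviCivita cov) (hn : 2 ≤ n) (x : M)
    (X Y Z W : TangentSpace I x) :
    g.bivectorCurvature cov x X Y Z W = g.bivectorCurvature cov x Z W X Y := by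
  simp only [bivectorCurvature, curvatureForm]
  have P := h.val_curvature_pair_symm hn x X Y W Z
  have A := val_curvature_antisymm (g := g) (cov := cov) x W Z X Y
  have S := h.val_curvature_skew hn x Z W X Y
  linarith

/-- Hamilton's block `A` is a symmetric matrix (in any 4-frame). [cite: Hamilton1997, §1.2, pp. 4–5] -/
theorem blockA_isSymm (h : g.IsLeviCivita cov) (hn : 2 ≤ n) (x : M)
    (e : Fin 4 → TangentSpace I x) : (g.blockA cov x e).IsSymm := by
  refine Matrix.IsSymm.ext fun i j ↦ ?_
  simp only [blockA, Matrix.of_apply, pairingCurvature]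
  rw [Finset.sum_comm]
  exact Finset.sum_congr rfl fun a _ ↦ Finset.sum_congr rfl fun b _ ↦
    bivectorCurvature_symm h hn x _ _ _ _

/-- Hamilton's block `C` is a symmetric matrix (in any 4-frame). [cite: Hamilton1997, §1.2, pp. 4–5] -/
theorem blockC_isSymm (h : g.IsLeviCivita cov) (hn : 2 ≤ n) (x : M)
    (e : Fin 4 → TangentSpace I x) : (g.blockC cov x e).IsSymm := by
  refine Matrix.IsSymm.ext fun i j ↦ ?_
  simp only [blockC, Matrix.of_apply, pairingCurvature]
  rw [Finset.sum_comm]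
  exact Finset.sum_congr rfl fun a _ ↦ Finset.sum_congr rfl fun b _ ↦
    bivectorCurvature_symm h hn x _ _ _ _

omit [FiniteDimensional ℝ E] [CompleteSpace E] in
/-- `C₂₂ = R₁₃₁₃ + R₂₄₂₄ + R₁₃₂₄ + R₂₄₁₃` (indices from `1`; Hamilton 1997, p. 5:
`C₂₂ = R₁₃₁₃ + R₄₂₄₂ - 2R₁₃₄₂`). [cite: Hamilton1997, §1.2, p. 5] -/
theorem blockC_apply_one_one (x : M) (e : Fin 4 → TangentSpace I x) :
    g.blockC cov x e 1 1 =
      g.bivectorCurvature cov x (e 0) (e 2) (e 0) (e 2) +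
        g.bivectorCurvature cov x (e 1) (e 3) (e 1) (e 3) +
        g.bivectorCurvature cov x (e 0) (e 2) (e 1) (e 3) +
        g.bivectorCurvature cov x (e 1) (e 3) (e 0) (e 2) := by
  simp [blockC, pairingCurvature, antiSelfDualPairs, Fin.sum_univ_two]
  ring

omit [FiniteDimensional ℝ E] [CompleteSpace E] in
/-- `C₃₃ = R₁₄₁₄ + R₃₂₃₂ + R₁₄₃₂ + R₃₂₁₄` (indices from `1`; Hamilton 1997, p. 5:
`C₃₃ = R₁₄₁₄ + R₂₃₂₃ - 2R₁₄₂₃`). [cite: Hamilton1997, §1.2, p. 5] -/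
theorem blockC_apply_two_two (x : M) (e : Fin 4 → TangentSpace I x) :
    g.blockC cov x e 2 2 =
      g.bivectorCurvature cov x (e 0) (e 3) (e 0) (e 3) +
        g.bivectorCurvature cov x (e 2) (e 1) (e 2) (e 1) +
        g.bivectorCurvature cov x (e 0) (e 3) (e 2) (e 1) +
        g.bivectorCurvature cov x (e 2) (e 1) (e 0) (e 3) := by
  simp [blockC, pairingCurvature, antiSelfDualPairs, Fin.sum_univ_two]
  ring

/-- **`tr A = tr C`** for Hamilton's blocks of the curvature of a Levi-Civita connection of a
`C^n` metric, `n ≥ 2`, in any 4-frame (Hamilton 1997, p. 9: "`a₁ + a₂ + a₃ = c₁ + c₂ + c₃` is the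
first Bianchi identity for `n = 4`"; Chen–Zhu 2006, p. 4): `Aᵢᵢ - Cᵢᵢ = ±4R(e₀∧eᵢ, e_j∧e_k)` and
the three terms add up to a Bianchi sum (O'Neill 1983, Prop. 3.36). No orthonormality is needed.
[cite: Hamilton1997, §2.1, Thm. 1.4 (proof, p. 9)] -/
theorem trace_blockA_eq_trace_blockC (h : g.IsLeviCivita cov) (hn : 2 ≤ n) (x : M)
    (e : Fin 4 → TangentSpace I x) : (g.blockA cov x e).trace = (g.blockC cov x e).trace := by
  have P := h.val_curvature_pair_symm hn x
  have Bi := h.val_curvature_cyclic hn x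
  have A := fun X Y Z W ↦ val_curvature_antisymm (g := g) (cov := cov) x X Y Z W
  have S := h.val_curvature_skew hn x
  rw [Matrix.trace_fin_three, Matrix.trace_fin_three, blockA_apply_zero_zero,
    blockA_apply_one_one, blockA_apply_two_two, blockC_apply_zero_zero, blockC_apply_one_one,
    blockC_apply_two_two]
  simp only [bivectorCurvature, curvatureForm]
  linarith [Bi (e 0) (e 1) (e 2) (e 3), A (e 2) (e 3) (e 3) (e 2), S (e 3) (e 2) (e 3) (e 2),
    S (e 0) (e 1) (e 3) (e 2), A (e 2) (e 3) (e 1) (e 0), P (e 2) (e 3) (e 1) (e 0),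
    A (e 1) (e 0) (e 2) (e 3), A (e 3) (e 1) (e 1) (e 3), S (e 1) (e 3) (e 1) (e 3),
    S (e 0) (e 2) (e 1) (e 3), A (e 3) (e 1) (e 2) (e 0), P (e 3) (e 1) (e 2) (e 0),
    A (e 2) (e 0) (e 3) (e 1), S (e 0) (e 2) (e 3) (e 1), A (e 1) (e 2) (e 2) (e 1),
    S (e 2) (e 1) (e 2) (e 1), S (e 0) (e 3) (e 2) (e 1), A (e 1) (e 2) (e 3) (e 0),
    P (e 1) (e 2) (e 3) (e 0), A (e 3) (e 0) (e 1) (e 2), S (e 0) (e 3) (e 1) (e 2),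
    P (e 0) (e 3) (e 2) (e 1), A (e 0) (e 2) (e 1) (e 3), A (e 2) (e 1) (e 0) (e 3)]

end LeviCivita

/-! ### ODE side: `{tr A = tr C}` and `{A, C symmetric}` are preserved by Hamilton's ODE -/

namespace HamiltonODE

/-- `tr (A²) + 2 tr (A^#) = (tr A)²` for `3 × 3` matrices (Hamilton 1986, p. 166: "Since
`tr A² + 2 tr A^# = (tr A)²` … it is easy to see that the Bianchi identity is preserved").
[cite: Hamilton1986, §6, p. 166] -/
theorem trace_mul_self_add_two_trace_sharp (A : Matrix (Fin 3) (Fin 3) ℝ) :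
    (A * A).trace + 2 * A.sharp.trace = A.trace ^ 2 := by
  simp only [Matrix.trace_fin_three, Matrix.mul_apply, Fin.sum_univ_three, Matrix.sharp,
    Matrix.transpose_apply, Matrix.adjugate_fin_three]
  simp
  ring

/-- Along Hamilton's field, `(tr A)' = (tr A)² + tr (BᵗB)`. [cite: Hamilton1986, §6, p. 166] -/
theorem trace_field_fst (p : Blocks) :
    (field p).1.trace = p.1.trace ^ 2 + (p.2.1 * p.2.1ᵀ).trace := by
  have h := trace_mul_self_add_two_trace_sharp p.1
  simp only [field, Matrix.trace_add, Matrix.trace_smul, smul_eq_mul]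
  linarith

/-- Along Hamilton's field, `(tr C)' = (tr C)² + tr (BᵗB)` (`tr (ᵗBB) = tr (BᵗB)`).
[cite: Hamilton1986, §6, p. 166] -/
theorem trace_field_snd_snd (p : Blocks) :
    (field p).2.2.trace = p.2.2.trace ^ 2 + (p.2.1 * p.2.1ᵀ).trace := by
  have h := trace_mul_self_add_two_trace_sharp p.2.2
  simp only [field, Matrix.trace_add, Matrix.trace_smul, smul_eq_mul]
  rw [Matrix.trace_mul_comm p.2.1ᵀ p.2.1]
  linarith

/-- The trace of the `A`-component of a differentiable curve of block triples is differentiable,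
with the expected derivative. [folklore] -/
theorem HasDerivAt.trace_fst {γ : ℝ → Blocks} {γ' : Blocks} {t : ℝ} (h : HasDerivAt γ γ' t) :
    _root_.HasDerivAt (fun s ↦ (γ s).1.trace) γ'.1.trace t := by
  simp only [Matrix.trace_fin_three]
  exact ((h.1 0 0).add (h.1 1 1)).add (h.1 2 2)

/-- … and likewise for the `C`-component. [folklore] -/
theorem HasDerivAt.trace_snd_snd {γ : ℝ → Blocks} {γ' : Blocks} {t : ℝ} (h : HasDerivAt γ γ' t) :
    _root_.HasDerivAt (fun s ↦ (γ s).2.2.trace) γ'.2.2.trace t := by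
  simp only [Matrix.trace_fin_three]
  exact ((h.2.2 0 0).add (h.2.2 1 1)).add (h.2.2 2 2)

/-- **The Bianchi constraint `tr A = tr C` is preserved by Hamilton's ODE** (Hamilton 1986, §6,
p. 166: "`tr A` and `tr C` satisfy the same equation"): along a solution, `y = tr A - tr C`
satisfies `y' = (tr A)² - (tr C)² = y (tr A + tr C)`, so `y(t₀) = 0` forces `y ≡ 0` on
`[t₀, t₁]` (Grönwall's inequality with the continuous, hence bounded, factor `tr A + tr C`).
[cite: Hamilton1986, §6, p. 166] -/
theorem isInvariant_trace_eq :
    IsInvariant field (fun _ ↦ {p : Blocks | p.1.trace = p.2.2.trace}) := by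
  refine isInvariant_iff.2 fun γ t₀ t₁ _ h₁ hγ hin ↦ ?_
  set y : ℝ → ℝ := fun s ↦ (γ s).1.trace - (γ s).2.2.trace with hy
  set k : ℝ → ℝ := fun s ↦ (γ s).1.trace + (γ s).2.2.trace with hk
  have hd : ∀ s ∈ Icc t₀ t₁, _root_.HasDerivAt y (y s * k s) s := by
    intro s hs
    have h := ((hγ s hs).trace_fst).sub ((hγ s hs).trace_snd_snd)
    rw [trace_field_fst, trace_field_snd_snd] at h
    refine h.congr_deriv ?_
    simp only [hy, hk]
    ring
  have hcont : ContinuousOn k (Icc t₀ t₁) := fun s hs ↦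
    (((hγ s hs).trace_fst).add ((hγ s hs).trace_snd_snd)).continuousAt.continuousWithinAt
  obtain ⟨C, hC⟩ := isCompact_Icc.exists_bound_of_continuousOn hcont
  have hy0 : y t₀ = 0 := sub_eq_zero.2 hin
  have key := norm_le_gronwallBound_of_norm_deriv_right_le (f := y) (f' := fun s ↦ y s * k s)
    (δ := 0) (K := C) (ε := 0) (a := t₀) (b := t₁)
    (fun s hs ↦ (hd s hs).continuousAt.continuousWithinAt)
    (fun s hs ↦ (hd s (Ico_subset_Icc_self hs)).hasDerivWithinAt)
    (by rw [hy0, norm_zero])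
    (fun s hs ↦ by
      rw [norm_mul, add_zero, mul_comm]
      exact mul_le_mul_of_nonneg_right (hC s (Ico_subset_Icc_self hs)) (norm_nonneg _))
    t₁ (right_mem_Icc.2 h₁)
  rw [gronwallBound_ε0_δ0] at key
  have : y t₁ = 0 := norm_le_zero_iff.1 key
  exact sub_eq_zero.1 this

/-- **The antisymmetric part of `X² + N + 2X^#` for symmetric `N`** (`3 × 3`): with `D = X - ᵗX`,
`(X² + N + 2X^#) - ᵗ(X² + N + 2X^#) = 2 (tr X) D - (X D + D ᵗX)` — a consequence of the
Cayley–Hamilton form `adj X = X² - (tr X) X + ½((tr X)² - tr X²)·1` of the adjugate, checked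
entrywise. [folklore] -/
theorem antisymm_quadratic_identity (X N : Matrix (Fin 3) (Fin 3) ℝ) (hN : Nᵀ = N) :
    (X * X + N + (2 : ℝ) • X.sharp) - (X * X + N + (2 : ℝ) • X.sharp)ᵀ =
      (2 * X.trace) • (X - Xᵀ) - (X * (X - Xᵀ) + (X - Xᵀ) * Xᵀ) := by
  have hN' : ∀ i j, N j i = N i j := fun i j ↦ by
    simpa [Matrix.transpose_apply] using congrFun (congrFun hN i) j
  ext i j
  simp only [Matrix.sub_apply, Matrix.transpose_apply, Matrix.add_apply, Matrix.smul_apply,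
    Matrix.mul_apply, Fin.sum_univ_three, Matrix.sharp, Matrix.adjugate_fin_three,
    Matrix.trace_fin_three, smul_eq_mul, hN' j i]
  fin_cases i <;> fin_cases j <;> simp <;> ring

/-- The `A`-component of Hamilton's field has antisymmetric part `2 (tr A) D - (A D + D ᵗA)`,
`D = A - ᵗA`: a linear equation for `D` along any solution. [folklore] -/
theorem field_fst_sub_transpose (p : Blocks) :
    (field p).1 - ((field p).1)ᵀ = (2 * p.1.trace) • (p.1 - p.1ᵀ) - (p.1 * (p.1 - p.1ᵀ) +
      (p.1 - p.1ᵀ) * p.1ᵀ) :=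
  antisymm_quadratic_identity p.1 (p.2.1 * p.2.1ᵀ) (by simp [Matrix.transpose_mul])

/-- Likewise for the `C`-component, `E = C - ᵗC`. [folklore] -/
theorem field_snd_snd_sub_transpose (p : Blocks) :
    (field p).2.2 - ((field p).2.2)ᵀ = (2 * p.2.2.trace) • (p.2.2 - p.2.2ᵀ) -
      (p.2.2 * (p.2.2 - p.2.2ᵀ) + (p.2.2 - p.2.2ᵀ) * p.2.2ᵀ) :=
  antisymm_quadratic_identity p.2.2 (p.2.1ᵀ * p.2.1) (by simp [Matrix.transpose_mul])

/-- **Grönwall for the antisymmetric part.** If a curve of `3 × 3` matrices `X` is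
differentiable on `[t₀, t₁]` with derivative `F`, the antisymmetric part of `F` is
`2 (tr X) D - (X D + D ᵗX)` with `D = X - ᵗX`, and `X(t₀)` is symmetric, then `X(t₁)` is symmetric
(the sup-norm of the entries of `D` satisfies `‖D'‖ ≤ c(t) ‖D‖` with `c` continuous). [folklore] -/
theorem isSymm_of_linear_antisymm {X F : ℝ → Matrix (Fin 3) (Fin 3) ℝ} {t₀ t₁ : ℝ} (h₁ : t₀ ≤ t₁)
    (hderiv : ∀ s ∈ Icc t₀ t₁, ∀ i j, _root_.HasDerivAt (fun s ↦ X s i j) (F s i j) s)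
    (hlin : ∀ s ∈ Icc t₀ t₁, F s - (F s)ᵀ = (2 * (X s).trace) • (X s - (X s)ᵀ) -
      (X s * (X s - (X s)ᵀ) + (X s - (X s)ᵀ) * (X s)ᵀ))
    (h0 : (X t₀).IsSymm) : (X t₁).IsSymm := by
  -- the antisymmetric part as a curve in `Fin 3 → Fin 3 → ℝ` (sup norm)
  set f : ℝ → (Fin 3 → Fin 3 → ℝ) := fun s i j ↦ X s i j - X s j i with hf
  set f' : ℝ → (Fin 3 → Fin 3 → ℝ) := fun s i j ↦ F s i j - F s j i with hf'
  have hd : ∀ s ∈ Icc t₀ t₁, _root_.HasDerivAt f (f' s) s := fun s hs ↦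
    hasDerivAt_pi.2 fun i ↦ hasDerivAt_pi.2 fun j ↦ (hderiv s hs i j).sub (hderiv s hs j i)
  -- a continuous coefficient bound
  set c : ℝ → ℝ := fun s ↦ 2 * |(X s).trace| + 2 * ∑ k, ∑ l, |X s k l| with hc
  have hXc : ∀ k l, ContinuousOn (fun s ↦ X s k l) (Icc t₀ t₁) := fun k l s hs ↦
    (hderiv s hs k l).continuousAt.continuousWithinAt
  have hcc : ContinuousOn c (Icc t₀ t₁) := by
    refine ((continuousOn_const.mul ?_).add (continuousOn_const.mul ?_))
    · simp only [Matrix.trace_fin_three]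
      exact (((hXc 0 0).add (hXc 1 1)).add (hXc 2 2)).abs
    · exact continuousOn_finsetSum _ fun k _ ↦ continuousOn_finsetSum _ fun l _ ↦ (hXc k l).abs
  obtain ⟨C, hC⟩ := isCompact_Icc.exists_bound_of_continuousOn hcc
  -- the entrywise linear identity and the bound `‖f' s‖ ≤ c s * ‖f s‖`
  have hentry : ∀ s ∈ Icc t₀ t₁, ∀ i j, f' s i j =
      2 * (X s).trace * f s i j - ∑ k, (X s i k * f s k j + f s i k * X s j k) := by
    intro s hs i j
    have e := congrFun (congrFun (hlin s hs) i) j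
    simp only [Matrix.sub_apply, Matrix.transpose_apply, Matrix.smul_apply, Matrix.add_apply,
      Matrix.mul_apply, smul_eq_mul] at e
    simp only [hf', hf]
    rw [e, Finset.sum_add_distrib]
  have hbound : ∀ s ∈ Icc t₀ t₁, ‖f' s‖ ≤ c s * ‖f s‖ := by
    intro s hs
    have hfs : ∀ k l, |f s k l| ≤ ‖f s‖ := fun k l ↦ by
      rw [← Real.norm_eq_abs]
      exact (norm_le_pi_norm (f s k) l).trans (norm_le_pi_norm (f s) k)
    have hrow : ∀ i, ∑ k, |X s i k| ≤ ∑ k, ∑ l, |X s k l| := fun i ↦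
      Finset.single_le_sum (f := fun k ↦ ∑ l, |X s k l|) (fun k _ ↦ by positivity)
        (Finset.mem_univ i)
    refine (pi_norm_le_iff_of_nonneg (by positivity)).2 fun i ↦
      (pi_norm_le_iff_of_nonneg (by positivity)).2 fun j ↦ ?_
    rw [Real.norm_eq_abs, hentry s hs i j]
    have p1 : |2 * (X s).trace * f s i j| ≤ 2 * |(X s).trace| * ‖f s‖ := by
      rw [abs_mul, abs_mul, abs_two]
      exact mul_le_mul_of_nonneg_left (hfs i j) (by positivity)
    have p2 : ∑ k, |X s i k * f s k j + f s i k * X s j k| ≤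
        ∑ k, (|X s i k| * ‖f s‖ + ‖f s‖ * |X s j k|) :=
      Finset.sum_le_sum fun k _ ↦ (abs_add_le _ _).trans (add_le_add
        (by rw [abs_mul]; exact mul_le_mul_of_nonneg_left (hfs k j) (abs_nonneg _))
        (by rw [abs_mul]; exact mul_le_mul_of_nonneg_right (hfs i k) (abs_nonneg _)))
    calc |2 * (X s).trace * f s i j - ∑ k, (X s i k * f s k j + f s i k * X s j k)|
        ≤ |2 * (X s).trace * f s i j| + ∑ k, |X s i k * f s k j + f s i k * X s j k| :=
          (abs_sub _ _).trans (add_le_add le_rfl (Finset.abs_sum_le_sum_abs _ _))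
      _ ≤ 2 * |(X s).trace| * ‖f s‖ + ∑ k, (|X s i k| * ‖f s‖ + ‖f s‖ * |X s j k|) :=
          add_le_add p1 p2
      _ = (2 * |(X s).trace| + (∑ k, |X s i k| + ∑ k, |X s j k|)) * ‖f s‖ := by
          rw [Finset.sum_add_distrib, ← Finset.sum_mul, ← Finset.mul_sum]; ring
      _ ≤ c s * ‖f s‖ := by
          refine mul_le_mul_of_nonneg_right ?_ (norm_nonneg _)
          simp only [hc]
          linarith [hrow i, hrow j]
  have hf0 : f t₀ = 0 := by
    funext i j
    simp only [hf, Pi.zero_apply, sub_eq_zero]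
    exact (h0.apply i j).symm
  have key := norm_le_gronwallBound_of_norm_deriv_right_le (f := f) (f' := f') (δ := 0) (K := C)
    (ε := 0) (a := t₀) (b := t₁)
    (fun s hs ↦ (hd s hs).continuousAt.continuousWithinAt)
    (fun s hs ↦ (hd s (Ico_subset_Icc_self hs)).hasDerivWithinAt)
    (by rw [hf0, norm_zero])
    (fun s hs ↦ by
      rw [add_zero]
      refine (hbound s (Ico_subset_Icc_self hs)).trans (mul_le_mul_of_nonneg_right ?_ (norm_nonneg _))
      exact (le_abs_self _).trans (by simpa using hC s (Ico_subset_Icc_self hs)))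
    t₁ (right_mem_Icc.2 h₁)
  rw [gronwallBound_ε0_δ0] at key
  have hft : f t₁ = 0 := norm_le_zero_iff.1 key
  refine Matrix.IsSymm.ext fun i j ↦ ?_
  have := congrFun (congrFun hft i) j
  simp only [hf, Pi.zero_apply, sub_eq_zero] at this
  exact this.symm

/-- **`{A, C symmetric}` is preserved by Hamilton's ODE** (the phase space of Hamilton 1986 is the
space of symmetric forms on `Λ²`; for the block triples this is the forward invariance of the
linear constraint `A = ᵗA`, `C = ᵗC`). [cite: Hamilton1986, §2, p. 157 and §6, p. 166] -/
theorem isInvariant_isSymm :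
    IsInvariant field (fun _ ↦ {p : Blocks | p.1.IsSymm ∧ p.2.2.IsSymm}) := by
  refine isInvariant_iff.2 fun γ t₀ t₁ _ h₁ hγ hin ↦ ⟨?_, ?_⟩
  · exact isSymm_of_linear_antisymm (X := fun s ↦ (γ s).1) (F := fun s ↦ (field (γ s)).1) h₁
      (fun s hs i j ↦ (hγ s hs).1 i j) (fun s _ ↦ field_fst_sub_transpose (γ s)) hin.1
  · exact isSymm_of_linear_antisymm (X := fun s ↦ (γ s).2.2) (F := fun s ↦ (field (γ s)).2.2) h₁
      (fun s hs i j ↦ (hγ s hs).2.2 i j) (fun s _ ↦ field_snd_snd_sub_transpose (γ s)) hin.2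

/-- `{A, C symmetric}` is closed. [folklore] -/
theorem isClosed_isSymm : IsClosed {p : Blocks | p.1.IsSymm ∧ p.2.2.IsSymm} :=
  (isClosed_eq continuous_fst.matrix_transpose continuous_fst).inter
    (isClosed_eq continuous_snd.snd.matrix_transpose continuous_snd.snd)

/-- `{A, C symmetric}` is convex (linear). [folklore] -/
theorem isSymm_combo {x y : Blocks} (hx : x.1.IsSymm ∧ x.2.2.IsSymm) (hy : y.1.IsSymm ∧ y.2.2.IsSymm)
    (a b : ℝ) : (a • x + b • y).1.IsSymm ∧ (a • x + b • y).2.2.IsSymm :=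
  ⟨(hx.1.smul a).add (hy.1.smul b), (hx.2.smul a).add (hy.2.smul b)⟩

end HamiltonODE

end Literature.Geometry.Riemannian

end
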